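import Literature.AlgebraicGeometry.ShimuraVarieties.KudlaRapoport2013.Sec7to10EisensteinSide
import Literature.NumberTheory.QuadraticForms.HilbertReciprocityRat
import Literature.NumberTheory.QuadraticForms.HilbertSymbolBilinear
import Literature.NumberTheory.QuadraticForms.HasseMinkowskiTernaryLemmas
import Mathlib.NumberTheory.Padics.HeightOneSpectrum
import Mathlib.RingTheory.Flat.Basic
import HarnessLib

/-!
# [KudlaRapoport2013, §9 after (9.2) (arXiv v2 p. 33)] «`Diff(T, V)` has odd cardinality» — DISCHARGED:
# `KR2013_9_diff_card_odd_holds`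

Kernel-lane companion of the statement carpet ★
`Literature/AlgebraicGeometry/ShimuraVarieties/KudlaRapoport2013/Sec7to10EisensteinSide.lean`: its CLOSED named fact ★
`KR2013_9_diff_card_odd` — S. Kudla, M. Rapoport, *Special cycles on unitary Shimura varieties II: global theory*, §9, the
sentence after (9.2) (arXiv:0912.3758v2 p. 33): «Note that … if `T > 0`, then `1 = χ_∞(det(T)) = −χ_∞(det(V))`, and hence
`Diff(T, V)` has odd cardinality, due to the product formula (1.2).» — typed: for `T` of signature `(n, 0)` and `J` of signature
`(n−1, 1)` at a complex embedding `τ` (`n ≥ 1`), ★ `diff k T J` is finite of odd cardinality — is PROVED here.  THEOREMS ONLY (no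
definition, no named fact, no `sorry`, no instance, no notation); cell hodgecm-mathlib, seat B-typ01 (g32); net debt −1.

## The proof (the printed argument, with the product formula = the tree's ★ `hilbertReciprocity_rat`)

Write `k = ℚ(θ)` with `θ² = D ∈ ℚ`, `σ(θ) = −θ` (`θ = x − σx` for any `x` moved by `σ`; `D < 0` since `τ(θ)` is purely
imaginary, `k` being CM).
* `χ_p` **is the Hilbert symbol** (`isLocalNormAt_iff_hilbertSymbol_padic`; the public edition is ★ `Sec9LocalCharacterHilbertSymbol.isLocalNormAt_iff_hilbertSymbol`): `ℚ_p ⊗ k = ℚ_p ⊗ 1 ⊕ ℚ_p ⊗ θ` and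
  `(x ⊗ 1 + y ⊗ θ)·(1 ⊗ σ)(x ⊗ 1 + y ⊗ θ) = (x² − D y²) ⊗ 1`, so `χ_p(c) = 1 ⟺ c = x² − D y²` is soluble in `ℚ_p ⟺ (c, D)_p = 1`
  (O'Meara 63:10, the tree's ★ `hilbertSymbol_eq_one_iff_exists_norm`); transported to the place `v ↔ p` of `ℚ` along Mathlib's
  `adicCompletion.padicEquiv` (★ `hilbertSymbol_map_ringEquiv`).
* **signatures give signs** (`exists_rat_det_of_hasSignatureAt`): `ᵗT̄ J^τ T = diag(1^{n−r}, (−1)^r)` forces `J^τ` hermitian, hence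
  `J` hermitian for `σ` (`τ ∘ σ = conj ∘ τ`), `det J = d ∈ ℚ` (fixed by `σ`), and `d · |det T|² = det diag = (−1)^r`; so `det T > 0`
  (`r = 0`) and `det J < 0` (`r = 1`, `n ≥ 1`).
* hence (`mem_diff_iff`) `p ∈ Diff(T, V) ⟺ (det T, D)_p ≠ (det J, D)_p ⟺ (det T · det J, D)_p = −1` (bimultiplicativity at every
  place, the tree's ★ `hilbertSymbol_adicCompletion_mul_left`), i.e. `Diff(T, V)` is the image under `v ↦ p_v` (Mathlib
  `Rat.HeightOneSpectrum.primesEquiv`) of the finite-place set of ★ `hilbertReciprocity ℚ (det T · det J) D`; at the unique infinite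
  place `(det T · det J, D)_∞ = −1` (both negative, ★ `hilbertSymbol_infinitePlace_rat_eq_neg_one_iff`), and ★ `hilbertReciprocity_rat`
  («the product formula (1.2)») says the total number of places with symbol `−1` is even: `|Diff(T, V)| + 1` is even.

## References
* [KudlaRapoport2013] S. Kudla, M. Rapoport, *Special cycles on unitary Shimura varieties II: global theory*, J. reine angew.
  Math. 697 (2014) 91–157; arXiv:0912.3758v2, §9 (9.2) and §1 (1.2) (pp. 33, 7).
* [Omeara1963] O. T. O'Meara, *Introduction to quadratic forms* (1963), §63B (63:10), §71 Thm. 71:18.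
* [Serre1973] J.-P. Serre, *A Course in Arithmetic* (1973), Ch. III §1.2 Thm. 1, §2.1 Thm. 3.
-/

set_option autoImplicit false

noncomputable section

open NumberField IsDedekindDomain Module
open Literature.NumberTheory.Automorphic.Liu2021.AppendixC (conj conj_ne_one conj_apply complexEmbedding_conj)
open Literature.AlgebraicGeometry.ShimuraVarieties.KudlaRapoport2013.Sec3ComplexUniformization
  (IsHermitianFor HasSignatureAt signDiag)
open Literature.NumberTheory.QuadraticForms
open scoped TensorProduct Matrix

namespace Literature.AlgebraicGeometry.ShimuraVarieties.KudlaRapoport2013.Sec7to10EisensteinSide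

variable (k : Type) [Field k] [NumberField k] [IsTotallyComplex k] [Algebra.IsQuadraticExtension ℚ k]

/-! ### `k = ℚ ⊕ ℚ θ` with `θ² = D < 0`, `σ(θ) = −θ` -/

/-- An element fixed by `σ` (= complex conjugation of the CM field `k`, Mathlib `IsCMField.complexConj`) is rational: the fixed
field of `σ` is the maximal real subfield `k⁺ = ℚ`. [folklore] -/
private theorem exists_rat_eq_of_conj_eq {x : k} (hx : conj ℚ k x = x) : ∃ q : ℚ, algebraMap ℚ k q = x := by
  letI : IsCMField k := IsCMField.ofCMExtension ℚ k
  have hx' : IsCMField.complexConj k x = x := hx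
  have hmem : x ∈ maximalRealSubfield k := (IsCMField.complexConj_eq_self_iff (K := k) x).1 hx'
  exact ⟨(CMExtension.equivMaximalRealSubfield ℚ k).symm ⟨x, hmem⟩, by
    rw [CMExtension.algebraMap_equivMaximalRealSubfield_symm_apply]; rfl⟩

/-- `σ` is an involution. [folklore] -/
private theorem conj_conj (x : k) : conj ℚ k (conj ℚ k x) = x := by
  letI : IsCMField k := IsCMField.ofCMExtension ℚ k
  exact IsCMField.complexConj_apply_apply (K := k) x

/-- **`k = ℚ(θ)` with `θ² = D < 0` and `σ(θ) = −θ`**: `θ = x − σ(x)` for any `x` not fixed by `σ`; `θ² ∈ ℚ` is negative because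
`τ(θ)` is a non-zero purely imaginary number (`τ ∘ σ = conj ∘ τ` for the CM field `k`). [folklore] -/
private theorem exists_theta (τ : k →+* ℂ) :
    ∃ (θ : k) (D : ℚ), θ ≠ 0 ∧ θ * θ = algebraMap ℚ k D ∧ conj ℚ k θ = -θ ∧ D < 0 := by
  obtain ⟨x, hx⟩ : ∃ x : k, conj ℚ k x ≠ x := by
    by_contra h
    push Not at h
    exact conj_ne_one ℚ k (AlgEquiv.ext fun a => (h a).trans (AlgEquiv.one_apply a).symm)
  set θ : k := x - conj ℚ k x with hθdef
  have hθσ : conj ℚ k θ = -θ := by rw [hθdef, map_sub, conj_conj]; ring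
  have hθ0 : θ ≠ 0 := fun h => hx (sub_eq_zero.1 h).symm
  have hfix : conj ℚ k (θ * θ) = θ * θ := by rw [map_mul, hθσ]; ring
  obtain ⟨D, hD⟩ := exists_rat_eq_of_conj_eq k hfix
  refine ⟨θ, D, hθ0, hD.symm, hθσ, ?_⟩
  have hstar : starRingEnd ℂ (τ θ) = -τ θ := by rw [← complexEmbedding_conj ℚ k τ θ, hθσ, map_neg]
  have hre : (τ θ).re = 0 := by
    have h := congrArg Complex.re hstar
    rw [Complex.conj_re, Complex.neg_re] at h
    linarith
  have hne : τ θ ≠ 0 := (map_ne_zero τ).2 hθ0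
  have him : (τ θ).im ≠ 0 := fun h => hne (Complex.ext (by simp [hre]) (by simp [h]))
  have hDC : ((D : ℝ) : ℂ) = τ θ * τ θ := by
    rw [← map_mul, ← hD, eq_ratCast, map_ratCast]; norm_cast
  have hDre : (D : ℝ) = -((τ θ).im ^ 2) := by
    have h := congrArg Complex.re hDC
    rw [Complex.ofReal_re, Complex.mul_re, hre] at h
    rw [h]; ring
  have hlt : (D : ℝ) < 0 := by rw [hDre]; exact neg_neg_of_pos (sq_pos_iff.mpr him)
  exact_mod_cast hlt

/-- Every `y ∈ k` is `a + b θ` with `a, b ∈ ℚ` (`a = (y + σy)/2`, `bθ = (y − σy)/2` are fixed by `σ`). [folklore] -/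
private theorem exists_rat_add_rat_mul {θ : k} (hθ0 : θ ≠ 0) (hθσ : conj ℚ k θ = -θ) (y : k) :
    ∃ a b : ℚ, y = algebraMap ℚ k a + algebraMap ℚ k b * θ := by
  have h2 : (2 : k) ≠ 0 := two_ne_zero
  obtain ⟨a, ha⟩ := exists_rat_eq_of_conj_eq k (x := (y + conj ℚ k y) / 2)
    (by rw [map_div₀, map_add, conj_conj, map_ofNat, add_comm])
  obtain ⟨b, hb⟩ := exists_rat_eq_of_conj_eq k (x := (y - conj ℚ k y) / (2 * θ))
    (by rw [map_div₀, map_sub, map_mul, conj_conj, map_ofNat, hθσ]; field_simp; ring)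
  refine ⟨a, b, ?_⟩
  rw [ha, hb]
  field_simp
  ring

/-! ### `χ_p` is the Hilbert symbol `( · , D)_p` -/

section Local

variable {k}
variable {θ : k} {D : ℚ} (hθ0 : θ ≠ 0) (hθ : θ * θ = algebraMap ℚ k D) (hθσ : conj ℚ k θ = -θ)
variable {p : ℕ} [Fact p.Prime]

include hθ hθσ in
/-- `(x ⊗ 1 + y ⊗ θ) · (1 ⊗ σ)(x ⊗ 1 + y ⊗ θ) = (x² − D y²) ⊗ 1` in `ℚ_p ⊗ k`. [folklore] -/
private theorem norm_tmul_eq (x y : ℚ_[p]) :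
    (x ⊗ₜ[ℚ] (1 : k) + y ⊗ₜ[ℚ] θ) *
        Algebra.TensorProduct.map (AlgHom.id ℚ ℚ_[p]) (conj ℚ k : k →ₐ[ℚ] k) (x ⊗ₜ[ℚ] (1 : k) + y ⊗ₜ[ℚ] θ) =
      (x * x - D • (y * y)) ⊗ₜ[ℚ] (1 : k) := by
  have hc1 : (conj ℚ k : k →ₐ[ℚ] k) 1 = 1 := map_one _
  have hcθ : (conj ℚ k : k →ₐ[ℚ] k) θ = -θ := hθσ
  rw [map_add, Algebra.TensorProduct.map_tmul, Algebra.TensorProduct.map_tmul, AlgHom.id_apply, AlgHom.id_apply, hc1,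
    hcθ, TensorProduct.tmul_neg]
  have hDk : algebraMap ℚ k D = D • (1 : k) := Algebra.algebraMap_eq_smul_one D
  calc (x ⊗ₜ[ℚ] (1 : k) + y ⊗ₜ[ℚ] θ) * (x ⊗ₜ[ℚ] (1 : k) + -(y ⊗ₜ[ℚ] θ))
      = x ⊗ₜ[ℚ] (1 : k) * (x ⊗ₜ[ℚ] (1 : k)) - y ⊗ₜ[ℚ] θ * (y ⊗ₜ[ℚ] θ) := by ring
    _ = (x * x) ⊗ₜ[ℚ] (1 : k) - (y * y) ⊗ₜ[ℚ] (θ * θ) := by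
        rw [Algebra.TensorProduct.tmul_mul_tmul, Algebra.TensorProduct.tmul_mul_tmul, mul_one]
    _ = (x * x) ⊗ₜ[ℚ] (1 : k) - (D • (y * y)) ⊗ₜ[ℚ] (1 : k) := by
        rw [hθ, hDk, TensorProduct.tmul_smul, TensorProduct.smul_tmul']
    _ = (x * x - D • (y * y)) ⊗ₜ[ℚ] (1 : k) := by rw [← TensorProduct.sub_tmul]

include hθ0 hθσ in
/-- `ℚ_p ⊗ k = ℚ_p ⊗ 1 + ℚ_p ⊗ θ`. [folklore] -/
private theorem exists_eq_tmul_add_tmul (z : ℚ_[p] ⊗[ℚ] k) : ∃ x y : ℚ_[p], z = x ⊗ₜ[ℚ] (1 : k) + y ⊗ₜ[ℚ] θ := by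
  induction z using TensorProduct.induction_on with
  | zero => exact ⟨0, 0, by simp⟩
  | tmul a w =>
      obtain ⟨α, β, hw⟩ := exists_rat_add_rat_mul k hθ0 hθσ w
      refine ⟨α • a, β • a, ?_⟩
      rw [hw, TensorProduct.tmul_add, Algebra.algebraMap_eq_smul_one, TensorProduct.tmul_smul, TensorProduct.smul_tmul',
        ← Algebra.smul_def, TensorProduct.tmul_smul, TensorProduct.smul_tmul']
  | add u w hu hw =>
      obtain ⟨x₁, y₁, rfl⟩ := hu
      obtain ⟨x₂, y₂, rfl⟩ := hw
      exact ⟨x₁ + x₂, y₁ + y₂, by rw [TensorProduct.add_tmul, TensorProduct.add_tmul]; abel⟩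

include hθ0 hθ hθσ in
/-- **`χ_p(c) = 1 ⟺ c = x² − D y²` in `ℚ_p`.** [cite: KudlaRapoport2013, §9 (9.2) (arXiv v2 p. 33)] -/
private theorem isLocalNormAt_iff_exists (c : ℚ) :
    IsLocalNormAt k p c ↔ ∃ x y : ℚ_[p], x * x - D • (y * y) = algebraMap ℚ ℚ_[p] c := by
  constructor
  · rintro ⟨z, hz⟩
    obtain ⟨x, y, rfl⟩ := exists_eq_tmul_add_tmul hθ0 hθσ z
    rw [norm_tmul_eq hθ hθσ] at hz
    refine ⟨x, y, ?_⟩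
    have hinj := Algebra.TensorProduct.includeLeft_injective (R := ℚ) (S := ℚ) (A := ℚ_[p]) (B := k)
      (algebraMap ℚ k).injective
    exact hinj hz
  · rintro ⟨x, y, h⟩
    exact ⟨x ⊗ₜ[ℚ] (1 : k) + y ⊗ₜ[ℚ] θ, by rw [norm_tmul_eq hθ hθσ, h]⟩

include hθ0 hθ hθσ in
/-- **`χ_p` is the Hilbert symbol**: for `c ∈ ℚ^×` (and `D ≠ 0`), `χ_p(c) = 1 ⟺ (c, D)_{ℚ_p} = 1` (O'Meara 63:10: `(D, c) = 1` iff
`c` is a norm from `ℚ_p(√D)`). [cite: Omeara1963, §63B (63:10)] -/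
private theorem isLocalNormAt_iff_hilbertSymbol_padic (hD0 : D ≠ 0) {c : ℚ} (hc : c ≠ 0) :
    IsLocalNormAt k p c ↔ hilbertSymbol ℚ_[p] (algebraMap ℚ ℚ_[p] c) (algebraMap ℚ ℚ_[p] D) = 1 := by
  rw [hilbertSymbol_comm, hilbertSymbol_eq_one_iff_exists_norm ((map_ne_zero _).2 hD0) ((map_ne_zero _).2 hc),
    isLocalNormAt_iff_exists hθ0 hθ hθσ]
  simp only [sq, Algebra.smul_def]

end Local

/-! ### Transport to the places of `ℚ` -/

/-- The Hilbert symbol of two rationals at the finite place `v` of `ℚ`, computed in `ℚ_v` or in `ℚ_p` (`p = p_v`, Mathlib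
`adicCompletion.padicEquiv`). [folklore] -/
private theorem hilbertSymbol_adicCompletion_eq_padic (v : HeightOneSpectrum (𝓞 ℚ))
    [Fact (Rat.HeightOneSpectrum.primesEquiv (R := 𝓞 ℚ) v : ℕ).Prime] (a b : ℚ) :
    hilbertSymbol (v.adicCompletion ℚ) (algebraMap ℚ _ a) (algebraMap ℚ _ b) =
      hilbertSymbol ℚ_[Rat.HeightOneSpectrum.primesEquiv (R := 𝓞 ℚ) v] (algebraMap ℚ _ a) (algebraMap ℚ _ b) := by
  let e := (Rat.HeightOneSpectrum.adicCompletion.padicEquiv (R := 𝓞 ℚ) v).toAlgEquiv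
  rw [← hilbertSymbol_map_ringEquiv e.toRingEquiv]
  have hea : ∀ q : ℚ, e.toRingEquiv (algebraMap ℚ (v.adicCompletion ℚ) q) =
      algebraMap ℚ ℚ_[Rat.HeightOneSpectrum.primesEquiv (R := 𝓞 ℚ) v] q := fun q => by
    change e (algebraMap ℚ (v.adicCompletion ℚ) q) = _
    rw [AlgEquiv.commutes]
  rw [hea, hea]

/-- `±1`-valued bookkeeping: `¬ (s = 1 ↔ t = 1)` iff `s t = −1`. [folklore] -/
private theorem not_iff_iff_mul_eq_neg_one {s t : ℤ} (hs : s = 1 ∨ s = -1) (ht : t = 1 ∨ t = -1) :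
    ¬ (s = 1 ↔ t = 1) ↔ s * t = -1 := by
  rcases hs with rfl | rfl <;> rcases ht with rfl | rfl <;> decide

section Places

variable {k}
variable {θ : k} {D : ℚ} (hθ0 : θ ≠ 0) (hθ : θ * θ = algebraMap ℚ k D) (hθσ : conj ℚ k θ = -θ) (hD0 : D ≠ 0)
variable {n : ℕ} {T J : Matrix (Fin n) (Fin n) k} {dT dJ : ℚ}
  (hdT : algebraMap ℚ k dT = T.det) (hdJ : algebraMap ℚ k dJ = J.det) (hdT0 : dT ≠ 0) (hdJ0 : dJ ≠ 0)

include hθ0 hθ hθσ hD0 hdT hdJ hdT0 hdJ0 in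
/-- **`p ∈ Diff(T, V) ⟺ (det T · det J, D)_p = −1`** at the finite place `v ↔ p` of `ℚ` (bimultiplicativity of the local symbol,
O'Meara §63B). [cite: KudlaRapoport2013, §9 (9.2) (arXiv v2 p. 33)] -/
private theorem mem_diff_iff (v : HeightOneSpectrum (𝓞 ℚ)) :
    (Rat.HeightOneSpectrum.primesEquiv (R := 𝓞 ℚ) v : ℕ) ∈ diff k T J ↔
      hilbertSymbol (v.adicCompletion ℚ) (algebraMap ℚ _ (dT * dJ)) (algebraMap ℚ _ D) = -1 := by
  haveI hp : Fact (Rat.HeightOneSpectrum.primesEquiv (R := 𝓞 ℚ) v : ℕ).Prime := ⟨(Rat.HeightOneSpectrum.primesEquiv v).2⟩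
  have key : ∀ c : ℚ, c ≠ 0 → (IsLocalNormAt k (Rat.HeightOneSpectrum.primesEquiv (R := 𝓞 ℚ) v : ℕ) c ↔
      hilbertSymbol (v.adicCompletion ℚ) (algebraMap ℚ _ c) (algebraMap ℚ _ D) = 1) := fun c hc => by
    rw [isLocalNormAt_iff_hilbertSymbol_padic hθ0 hθ hθσ hD0 hc, hilbertSymbol_adicCompletion_eq_padic]
  have hne : ∀ {c : ℚ}, c ≠ 0 → (algebraMap ℚ (v.adicCompletion ℚ) c) ≠ 0 := fun hc => (map_ne_zero _).2 hc
  have hmul : hilbertSymbol (v.adicCompletion ℚ) (algebraMap ℚ _ (dT * dJ)) (algebraMap ℚ _ D) =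
      hilbertSymbol (v.adicCompletion ℚ) (algebraMap ℚ _ dT) (algebraMap ℚ _ D) *
        hilbertSymbol (v.adicCompletion ℚ) (algebraMap ℚ _ dJ) (algebraMap ℚ _ D) := by
    rw [map_mul, hilbertSymbol_adicCompletion_mul_left ℚ v (hne hdT0) (hne hdJ0) (hne hD0)]
  have hiff : (Rat.HeightOneSpectrum.primesEquiv (R := 𝓞 ℚ) v : ℕ) ∈ diff k T J ↔
      ¬ (IsLocalNormAt k (Rat.HeightOneSpectrum.primesEquiv (R := 𝓞 ℚ) v : ℕ) dT ↔
          IsLocalNormAt k (Rat.HeightOneSpectrum.primesEquiv (R := 𝓞 ℚ) v : ℕ) dJ) := by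
    constructor
    · rintro ⟨_, h⟩
      exact h dT dJ hdT hdJ
    · intro h
      refine ⟨hp, fun dT' dJ' h1 h2 => ?_⟩
      obtain rfl : dT' = dT := (algebraMap ℚ k).injective (h1.trans hdT.symm)
      obtain rfl : dJ' = dJ := (algebraMap ℚ k).injective (h2.trans hdJ.symm)
      exact h
  rw [hiff, key dT hdT0, key dJ hdJ0,
    not_iff_iff_mul_eq_neg_one (hilbertSymbol_eq_one_or_eq_neg_one _ _) (hilbertSymbol_eq_one_or_eq_neg_one _ _), hmul]

end Places

/-! ### Signatures give the signs of the determinants -/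

/-- `det diag(1, …, 1) = 1`. [folklore] -/
private theorem det_signDiag_zero (n : ℕ) : (signDiag n 0).det = 1 := by
  rw [signDiag, Matrix.det_diagonal]
  exact Finset.prod_eq_one fun i _ => by simp [i.2]

/-- `det diag(1, …, 1, −1) = −1` (`n ≥ 1`). [folklore] -/
private theorem det_signDiag_one {n : ℕ} (hn : 1 ≤ n) : (signDiag n 1).det = -1 := by
  obtain ⟨m, rfl⟩ : ∃ m, n = m + 1 := ⟨n - 1, by omega⟩
  rw [signDiag, Matrix.det_diagonal, Fin.prod_univ_castSucc]
  rw [Finset.prod_eq_one fun i _ => by simp [i.2]]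
  simp

/-- From a Sylvester normal form `ᵗT̄ J^τ T = diag(±1)`: `J` is hermitian for `σ` and `det J = d ∈ ℚ` with `d · c = det diag(±1)` for
some real `c > 0` (`c = |det T|²`). [folklore] -/
private theorem exists_rat_det_of_hasSignatureAt {n : ℕ} {τ : k →+* ℂ} {J : Matrix (Fin n) (Fin n) k} {r : ℕ}
    (h : HasSignatureAt τ J r) :
    IsHermitianFor (conj ℚ k : k →+* k) J ∧
      ∃ (d : ℚ) (c : ℝ), 0 < c ∧ algebraMap ℚ k d = J.det ∧ (((d : ℝ) * c : ℝ) : ℂ) = (signDiag n r).det := by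
  obtain ⟨U, hU⟩ := h
  set M : Matrix (Fin n) (Fin n) ℂ := (U : Matrix (Fin n) (Fin n) ℂ) with hM
  have hMu : IsUnit M := U.isUnit
  have hMH : IsUnit Mᴴ := (Matrix.isUnit_conjTranspose M).2 hMu
  have hSH : (signDiag n r)ᴴ = signDiag n r := by
    rw [signDiag, Matrix.diagonal_conjTranspose]
    congr 1
    funext i
    rw [Pi.star_apply]
    split_ifs <;> simp
  -- `J^τ` is hermitian
  have hH : (J.map τ)ᴴ = J.map τ := by
    have h1 := congrArg Matrix.conjTranspose hU
    rw [Matrix.conjTranspose_mul, Matrix.conjTranspose_mul, Matrix.conjTranspose_conjTranspose, hSH, ← hU,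
      ← Matrix.mul_assoc] at h1
    exact hMH.mul_right_inj.1 (hMu.mul_left_inj.1 h1)
  have hherm : IsHermitianFor (conj ℚ k : k →+* k) J := by
    intro i j
    apply τ.injective
    have hij := congrFun (congrFun hH j) i
    rw [Matrix.conjTranspose_apply, Matrix.map_apply, Matrix.map_apply] at hij
    rw [show ((conj ℚ k : k →+* k) (J i j)) = conj ℚ k (J i j) from rfl, complexEmbedding_conj, starRingEnd_apply, hij]
  -- the determinant: `det J = d ∈ ℚ` and `conj(det M) · d · det M = det diag`
  have hconj : conj ℚ k J.det = J.det := by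
    have h := (conj ℚ k : k →+* k).map_det J
    have hmap : (conj ℚ k : k →+* k).mapMatrix J = J.transpose := by
      ext i j
      exact hherm i j
    rw [hmap, Matrix.det_transpose] at h
    exact h
  obtain ⟨d, hd⟩ := exists_rat_eq_of_conj_eq k hconj
  have hdet := congrArg Matrix.det hU
  rw [Matrix.det_mul, Matrix.det_mul, Matrix.det_conjTranspose] at hdet
  have hτ : (J.map τ).det = τ J.det := by rw [← RingHom.mapMatrix_apply, ← RingHom.map_det]
  have hτd : τ J.det = (d : ℂ) := by rw [← hd, eq_ratCast, map_ratCast]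
  rw [hτ, hτd] at hdet
  have hM0 : M.det ≠ 0 := ((Matrix.isUnit_iff_isUnit_det M).1 hMu).ne_zero
  refine ⟨hherm, d, Complex.normSq M.det, Complex.normSq_pos.2 hM0, hd, ?_⟩
  rw [← hdet, Complex.ofReal_mul, Complex.ofReal_ratCast, Complex.normSq_eq_conj_mul_self, ← starRingEnd_apply]
  ring

/-- Signature `(n, 0)` at `τ`: `T` is hermitian with rational `det T > 0`. [folklore] -/
private theorem det_pos_of_hasSignatureAt_zero {n : ℕ} {τ : k →+* ℂ} {T : Matrix (Fin n) (Fin n) k}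
    (h : HasSignatureAt τ T 0) :
    IsHermitianFor (conj ℚ k : k →+* k) T ∧ ∃ d : ℚ, algebraMap ℚ k d = T.det ∧ 0 < d := by
  obtain ⟨hh, d, c, hc, hd, hdc⟩ := exists_rat_det_of_hasSignatureAt k h
  rw [det_signDiag_zero] at hdc
  have h1 : (d : ℝ) * c = 1 := by exact_mod_cast hdc
  have hdpos : 0 < (d : ℝ) := by nlinarith
  exact ⟨hh, d, hd, by exact_mod_cast hdpos⟩

/-- Signature `(n−1, 1)` at `τ` (`n ≥ 1`): `J` is hermitian with rational `det J < 0`. [folklore] -/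
private theorem det_neg_of_hasSignatureAt_one {n : ℕ} (hn : 1 ≤ n) {τ : k →+* ℂ} {J : Matrix (Fin n) (Fin n) k}
    (h : HasSignatureAt τ J 1) :
    IsHermitianFor (conj ℚ k : k →+* k) J ∧ ∃ d : ℚ, algebraMap ℚ k d = J.det ∧ d < 0 := by
  obtain ⟨hh, d, c, hc, hd, hdc⟩ := exists_rat_det_of_hasSignatureAt k h
  rw [det_signDiag_one hn] at hdc
  have h1 : (d : ℝ) * c = -1 := by exact_mod_cast hdc
  have hdneg : (d : ℝ) < 0 := by nlinarith
  exact ⟨hh, d, hd, by exact_mod_cast hdneg⟩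

/-! ### Assembly -/

/-- ★ `KR2013_9_diff_card_odd` HOLDS. [KudlaRapoport2013, §9, after (9.2) (arXiv v2 p. 33)]: «if `T > 0`, then
`1 = χ_∞(det(T)) = −χ_∞(det(V))`, and hence `Diff(T, V)` has odd cardinality, due to the product formula (1.2).» — for `T` of
signature `(n, 0)` and `V = (kⁿ, J)` of signature `(n−1, 1)` at `τ`, `n ≥ 1`: `det T > 0 > det J` are rational, `χ_p = ( · , D)_p`
(`k = ℚ(√D)`), `Diff(T, V) = {p : (det T det J, D)_p = −1}`, `(det T det J, D)_∞ = −1`, and Hilbert reciprocity (the tree's ★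
`hilbertReciprocity_rat`, O'Meara 71:18) makes the total number of places with symbol `−1` even.
[cite: KudlaRapoport2013, §9 (9.2) (arXiv v2 p. 33)] -/
theorem KR2013_9_diff_card_odd_holds : KR2013_9_diff_card_odd k := by
  intro n τ T J hn hT hJ
  obtain ⟨θ, D, hθ0, hθ, hθσ, hDneg⟩ := exists_theta k τ
  have hD0 : D ≠ 0 := hDneg.ne
  obtain ⟨-, dT, hdT, hdTpos⟩ := det_pos_of_hasSignatureAt_zero k hT
  obtain ⟨-, dJ, hdJ, hdJneg⟩ := det_neg_of_hasSignatureAt_one k hn hJ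
  have hdT0 : dT ≠ 0 := hdTpos.ne'
  have hdJ0 : dJ ≠ 0 := hdJneg.ne
  have ha : dT * dJ < 0 := mul_neg_of_pos_of_neg hdTpos hdJneg
  obtain ⟨hfin, heven⟩ := (hilbertReciprocity_rat (dT * dJ) D) ha.ne hD0
  have hinf : {w : InfinitePlace ℚ |
      hilbertSymbol w.Completion (algebraMap ℚ _ (dT * dJ)) (algebraMap ℚ _ D) = -1} = Set.univ :=
    Set.eq_univ_of_forall fun w => (hilbertSymbol_infinitePlace_rat_eq_neg_one_iff w _ _).2 ⟨ha.le, hDneg.le⟩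
  rw [hinf, Set.ncard_univ, Nat.card_unique] at heven
  have hdiff : diff k T J = (fun v : HeightOneSpectrum (𝓞 ℚ) => (Rat.HeightOneSpectrum.primesEquiv (R := 𝓞 ℚ) v : ℕ)) ''
      {v : HeightOneSpectrum (𝓞 ℚ) |
        hilbertSymbol (v.adicCompletion ℚ) (algebraMap ℚ _ (dT * dJ)) (algebraMap ℚ _ D) = -1} := by
    ext p
    constructor
    · intro hp
      obtain ⟨hpF, _⟩ := id hp
      have hvp : (Rat.HeightOneSpectrum.primesEquiv (R := 𝓞 ℚ)
          ((Rat.HeightOneSpectrum.primesEquiv (R := 𝓞 ℚ)).symm ⟨p, hpF.out⟩) : ℕ) = p := by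
        rw [Equiv.apply_symm_apply]
      refine ⟨(Rat.HeightOneSpectrum.primesEquiv (R := 𝓞 ℚ)).symm ⟨p, hpF.out⟩, ?_, hvp⟩
      apply (mem_diff_iff hθ0 hθ hθσ hD0 hdT hdJ hdT0 hdJ0 _).1
      rw [hvp]
      exact hp
    · rintro ⟨v, hv, rfl⟩
      exact (mem_diff_iff hθ0 hθ hθσ hD0 hdT hdJ hdT0 hdJ0 v).2 hv
  have hinj : Function.Injective
      (fun v : HeightOneSpectrum (𝓞 ℚ) => (Rat.HeightOneSpectrum.primesEquiv (R := 𝓞 ℚ) v : ℕ)) :=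
    fun v w h => (Rat.HeightOneSpectrum.primesEquiv (R := 𝓞 ℚ)).injective (Subtype.ext h)
  rw [hdiff]
  refine ⟨hfin.image _, ?_⟩
  rw [Set.ncard_image_of_injective _ hinj]
  exact Nat.not_even_iff_odd.1 (Nat.even_add_one.1 heven)

end Literature.AlgebraicGeometry.ShimuraVarieties.KudlaRapoport2013.Sec7to10EisensteinSide
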